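import Summits.NavierStokesRegularity.NavierStokesRegularity.Theorems.ExtremiserTransienceNearExtremalTransiencePerFlowMemberSelectionStubZoomPackage
import Summits.NavierStokesRegularity.NavierStokesRegularity.Theorems.ExtremiserTransienceNearExtremalTransienceExtremiserLiouvillePlateau
import Summits.NavierStokesRegularity.NavierStokesRegularity.Theorems.ExtremiserTransiencePlateauSliceRigidity
import Summits.NavierStokesRegularity.NavierStokesRegularity.Theorems.ExtremiserTransiencePerFlowScaleLock
import Summits.NavierStokesRegularity.NavierStokesRegularity.Theorems.LiouvilleConjectureNS
import HarnessLib

/-!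
# Route `ExtremiserTransience`, crux `NearExtremalTransiencePerFlow` (stmt-NavierStokesRegularity-26567),
# LINE g7-δ «coherent member selection»: the PROVED part of the line over the texts of record —
# T0, the extremal-branch kill, the placement of T3 below (L), and the reduction of the crux to T1 ∧ T3 BY NAME

`--supports stmt-NavierStokesRegularity-26567` (helper; LINE δ = `Cruxes/NearExtremalTransiencePerFlow/Lines/member_selection.lean` v4,
critic verdict PASS idea-crit-4 2026-08-28T19:12:24Z; δ is a published, director-activatable line, NOT the registered skeleton of record,
so its pieces land as helpers).  This is the planner's sorry-free companion file `Lines/member_selection_theorems.lean` (critic note N2: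
«move the proved part to `Theorems/` so the board shows the residual by name»), landed by a prover hand and REWRITTEN ONTO THE LANDED
TEXTS OF RECORD instead of re-declaring them: `PFC`/`IsViolator` are `…Theorems.NearExtremalTransiencePerFlow.ZoneTransversality.*`
(file `ExtremiserTransienceZoneTransversalityDefs`), `EfficientTimesData`/`NearExtremalFamily`/`ZoomCompact`/`ZoomPackage` are
`…Theorems.NearExtremalTransiencePerFlow.MemberSelection.*` (file `ExtremiserTransienceMemberSelectionDefs`, seat ns-net-p2), and T2
`ZoomPackage` is the landed theorem `MemberSelection.stub_zoomPackage` (file `…MemberSelectionStubZoomPackage`, seat ns-net-p2).  All bodies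
are byte-identical to the line's §0/§1, so the line's own statements close by `exact`.

Content (kernel-checked):
* §0 the two remaining vocabulary items `IsExtremalSlice` (slice clause of items 26569/27696 verbatim) and `IsTubeSlice`; §1 the statements
  T0 `EfficientTimesNoDust`, T1 `CoherentSelection`, T3 `NoTubeSlice` (T2 `ZoomPackage` is imported);
* `share_le_of_taylor` — the share bound of the selection lever (pure algebra): cores of Taylor scale `≥ L₁` carry total
  Cauchy–Schwarz weight `≤ (√Θ/L₁)·√(ZP)` under the Taylor bound `Z ≤ ΘP`;
* `efficientTimesNoDust_holds : EfficientTimesNoDust` (T0) — a violator flow has late times `t n → T`, strictly `κ⋆(1-1/(n+2))`-efficient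
  at a height bound `Mb n > 0`, with non-trivial budgets AND the Taylor bound `Z ≤ Θ·ν(T-t n)·P` — from the landed sequential upper scale
  lock `PerFlow.upperLock_at_nearEfficient_times` and the flow-wise sharp inequality `flowwise_of_universal sharpDepletion_is_universal`;
* `not_isExtremalSlice_of_typeIAncientMild` — NO slice of a Type-I ancient mild field is an exactly extremal extended slice: equality in
  the landed `ExtremiserLiouville.extendedSharp` gives a plateau of positive volume (`ext_interior_contact_nonempty_of_extremal`), which
  the landed `plateauSliceRigidity` (item 27823) excludes (the one-slice form of ns-idea-10's K1 bypass);
* `noTubeSlice_of_liouvilleConjectureNS : LiouvilleConjectureNS → NoTubeSlice` — T3 sits below the canonical conjecture (L);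
* `nearExtremalTransiencePerFlow_of_selection : CoherentSelection → ZoomPackage → NoTubeSlice → NearExtremalTransiencePerFlow` — the
  rung 26567 by name from the three pieces, and, with T2 discharged by the landed `stub_zoomPackage`,
  `nearExtremalTransiencePerFlow_of_coherentSelection_of_noTubeSlice : CoherentSelection → NoTubeSlice → NearExtremalTransiencePerFlow` —
  after this file the OPEN content of LINE g7-δ is exactly {`CoherentSelection` (T1, the new lever), `NoTubeSlice` (T3, the one open
  heart, below (L))}, BY NAME.
HONEST FRAMING: T0 and the reductions are statements about hypothetical Type-I singular flows (vacuous if none exist); T1 and T3 are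
OPEN and nothing here proves them; nothing about Navier–Stokes regularity or blow-up is proved, and no summit is proved by a line.
Authors: planner ns-idea-5 g7 (text), prover seat ns-net-p1 g2 (landing, re-basing on the texts of record, T2 discharge). [folklore]
-/

noncomputable section

open scoped Topology InnerProductSpace RealInnerProductSpace ENNReal ContDiff
open MeasureTheory Filter Set Metric
open Literature.Analysis.FluidPDE
open Summit.NavierStokesRegularity.NavierStokesRegularity.Theses.ExtremiserTransience
open Summit.NavierStokesRegularity.NavierStokesRegularity.Theorems
open Summit.NavierStokesRegularity.NavierStokesRegularity.Theorems.ExtremiserLiouville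
open Summit.NavierStokesRegularity.NavierStokesRegularity.Theorems.DepletionLadder.KStar.HalfSpace
open Summit.NavierStokesRegularity.NavierStokesRegularity.Theorems.NearExtremalTransiencePerFlow.ZoneTransversality

namespace Summit.NavierStokesRegularity.NavierStokesRegularity.Theorems.NearExtremalTransiencePerFlow.MemberSelection

-- the problem directory repeats the summit name (`NavierStokesRegularity/NavierStokesRegularity`)
set_option linter.dupNamespace false
set_option linter.style.longLine false

/-! ## §0 Vocabulary (the rest is imported: `PFC`/`IsViolator` from `…ZoneTransversalityDefs`, `EfficientTimesData`/`NearExtremalFamily`/`ZoomCompact`/`ZoomPackage` from `…MemberSelectionDefs`) -/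

/-- An EXACTLY EXTREMAL EXTENDED SLICE (verbatim slice clause of items 26569/27696 with `W t ↦ w`): smooth, divergence-free,
bounded gradient, `D¹w, D²w ∈ L²`, and a height bound `M` with `0 < M√Z√P` at which `κ⋆·M·√Z·√P ≤ |J(w)|`. -/
def IsExtremalSlice (w : EuclideanSpace ℝ (Fin 3) → EuclideanSpace ℝ (Fin 3)) : Prop :=
  (ContDiff ℝ (⊤ : ℕ∞) w ∧ Literature.Analysis.FluidPDE.VectorCalculus.IsDivFree w ∧ (∃ B : ℝ, ∀ x, ‖fderiv ℝ w x‖ ≤ B) ∧ (∫⁻ x, ‖iteratedFDeriv ℝ 1 w x‖ₑ ^ 2 < ⊤) ∧ (∫⁻ x, ‖iteratedFDeriv ℝ 2 w x‖ₑ ^ 2 < ⊤) ∧ ∃ M : ℝ, (∀ x, ‖w x‖ ≤ M) ∧ 0 < M * Real.sqrt (∫ x, ‖Literature.Analysis.FluidPDE.curl w x‖ ^ 2) * Real.sqrt (∫ x, Literature.Analysis.FluidPDE.frobeniusNormSq (fderiv ℝ (Literature.Analysis.FluidPDE.curl w) x)) ∧ (sInf {κ : ℝ | (∀ (v : EuclideanSpace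 ℝ (Fin 3) → EuclideanSpace ℝ (Fin 3)) (M B : ℝ), ContDiff ℝ (⊤ : ℕ∞) v → Literature.Analysis.FluidPDE.VectorCalculus.IsDivFree v → (∀ x, ‖v x‖ ≤ M) → (∀ x, ‖fderiv ℝ v x‖ ≤ B) → (∫⁻ x, ‖iteratedFDeriv ℝ 0 v x‖ₑ ^ 2 < ⊤) → (∫⁻ x, ‖iteratedFDeriv ℝ 1 v x‖ₑ ^ 2 < ⊤) → (∫⁻ x, ‖iteratedFDeriv ℝ 2 v x‖ₑ ^ 2 < ⊤) → |∫ x, ⟪Literature.Analysis.FluidPDE.curl v x, fderiv ℝ v x (Literature.Analysis.FluidPDE.curl v x)⟫_ℝ| ≤ κ * M * Real.sqrt (∫ x, ‖Literature.Analysis.FluidPDE.curl v x‖ ^ 2) * Real.sqrt (∫ x, Literature.Analysis.FluidPDE.frobeniusNormSq (fderiv ℝ (Literature.Analysis.FluidPDE.curl v) x)))}) * M * Real.sqrt (∫ x, ‖Literature.Analysis.FluidPDE.curl w x‖ ^ 2) * Real.sqrt (∫ x, Literature.Analysis.FluidPDE.frobeniusNormSq (fderiv ℝ (Literature.Analysis.FluidPDE.curl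 w) x)) ≤ |∫ x, ⟪Literature.Analysis.FluidPDE.curl w x, fderiv ℝ w x (Literature.Analysis.FluidPDE.curl w x)⟫_ℝ|)

/-- A TUBE SLICE: smooth, divergence-free, bounded gradient, height bound `M`, INFINITE budget (`D¹w` or `D²w` not in `L²`), and
asymptotically `κ⋆`-efficient at height `M` along an exhaustion by bounded measurable sets `D k ⊇ B(0, ρ k)`, `ρ k → ∞`, with
deficits `δ k → 0` (plain restricted integrals — no cut-off correction).  The single-slice, exhaustion form of item 27695's sheet. -/
def IsTubeSlice (w : EuclideanSpace ℝ (Fin 3) → EuclideanSpace ℝ (Fin 3)) : Prop :=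
  ContDiff ℝ (⊤ : ℕ∞) w ∧ Literature.Analysis.FluidPDE.VectorCalculus.IsDivFree w ∧ (∃ B : ℝ, ∀ x, ‖fderiv ℝ w x‖ ≤ B) ∧
    ¬ ((∫⁻ x, ‖iteratedFDeriv ℝ 1 w x‖ₑ ^ 2 < ⊤) ∧ (∫⁻ x, ‖iteratedFDeriv ℝ 2 w x‖ₑ ^ 2 < ⊤)) ∧
    ∃ (M : ℝ) (D : ℕ → Set (EuclideanSpace ℝ (Fin 3))) (ρ δ : ℕ → ℝ), (∀ x, ‖w x‖ ≤ M) ∧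
      Tendsto ρ atTop atTop ∧ Tendsto δ atTop (𝓝 0) ∧
      ∀ k, MeasurableSet (D k) ∧ Metric.ball 0 (ρ k) ⊆ D k ∧ Bornology.IsBounded (D k) ∧
        (kStar - δ k) * M * Real.sqrt (∫ x in D k, ‖curl w x‖ ^ 2) * Real.sqrt (∫ x in D k, frobeniusNormSq (fderiv ℝ (curl w) x)) ≤
          |∫ x in D k, ⟪curl w x, fderiv ℝ w x (curl w x)⟫_ℝ|

/-! ## §1 The four statements of the line -/

/-- (T0 — PROVED in §1c, the sequential «no dust» form of the upper scale lock) EFFICIENT TIMES WITH A TAYLOR BOUND: a violator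
flow has a sequence of late times `t n → T` that are near-efficient (deficit `→ 0`) AND carry the Taylor bound `Z ≤ Θ·ν(T-t)·P`
(dissipation length at most parabolic).  Both halves at once are the landed `PerFlow.upperLock_at_nearEfficient_times` (g4-α:
`lockedTimes_logDensity` + `efficientTimes_logDensity_of_not_perFlow`); the opposite half `Z/P ≳ ν(T-t)` at near-efficient times is
the landed `PerFlow.lowerLock_at_nearEfficient_times` (not needed here). -/
def EfficientTimesNoDust : Prop :=
  ∀ (C ν T : ℝ) (u : ℝ → EuclideanSpace ℝ (Fin 3) → EuclideanSpace ℝ (Fin 3)) (p : ℝ → EuclideanSpace ℝ (Fin 3) → ℝ),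
    IsViolator C ν T u p → ∃ (Θ : ℝ) (t Mb ε : ℕ → ℝ), EfficientTimesData ν T u Θ t Mb ε

/-- (T1 — the NEW LEVER, slice-level pure analysis) COHERENT SELECTION: a near-extremal height-`1` family with a Taylor bound has
centres, a subsequence and a pointwise limit of translates which is an exactly extremal extended slice (finite budget) or a tube
slice (infinite budget).  Mechanism: cell-wise Cauchy–Schwarz at global height; share of a cell of Taylor scale `L` is
`≤ √(Z/P)/L ≤ √Θ/L`; nested selection; `C^∞_loc` compactness from the uniform bounds; `extendedSharp` closes the finite case. -/
def CoherentSelection : Prop :=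
  ∀ (v : ℕ → EuclideanSpace ℝ (Fin 3) → EuclideanSpace ℝ (Fin 3)) (Λ : ℕ → ℝ) (Θ : ℝ) (ε : ℕ → ℝ),
    NearExtremalFamily v Λ Θ ε →
      ∃ (y : ℕ → EuclideanSpace ℝ (Fin 3)) (φ : ℕ → ℕ) (W₀ : EuclideanSpace ℝ (Fin 3) → EuclideanSpace ℝ (Fin 3)),
        StrictMono φ ∧ (∀ z, Tendsto (fun n => v (φ n) (y (φ n) + z)) atTop (𝓝 (W₀ z))) ∧
        (IsExtremalSlice W₀ ∨ IsTubeSlice W₀)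

/-- (T3 — OPEN HEART #2) NO TUBE SLICE: no slice of a Type-I ancient mild field is a tube slice (infinite budget, asymptotically
`κ⋆`-efficient along an exhaustion).  The single-slice form of item 27695 `NoQuantumSheet`; implied by the KNSS Type-I Liouville
conjecture (`W ≡ 0`); constants, 2D and axisymmetric-no-swirl Type-I ancient fields are excluded by KNSS 2009 Thms 1.1–1.3. -/
def NoTubeSlice : Prop :=
  ∀ (K : ℝ) (W : ℝ → EuclideanSpace ℝ (Fin 3) → EuclideanSpace ℝ (Fin 3)) (s : ℝ),
    Literature.Analysis.FluidPDE.IsTypeIAncientMild K W → s < 0 → ¬ IsTubeSlice (W s)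

/-! ## §1b First lemma of the new lever: the share bound -/

/-- **First lemma of T1, PROVED** — the SHARE BOUND (pure algebra): cores of Taylor scale ≥ L₁ (`L₁² P_i ≤ Z_i`) have total CS-weight
`Σ √(Z_i P_i) ≤ (√Θ / L₁) · √(Z P)` under the Taylor bound `Z ≤ Θ P`, where `Σ Z_i ≤ Z`. -/
theorem share_le_of_taylor {ι : Type*} (s : Finset ι) (Zc Pc : ι → ℝ) (Z P Θ L₁ : ℝ)
    (hL₁ : 0 < L₁) (hPc : ∀ i ∈ s, 0 ≤ Pc i) (hlow : ∀ i ∈ s, L₁ ^ 2 * Pc i ≤ Zc i)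
    (hsum : ∑ i ∈ s, Zc i ≤ Z) (hP : 0 ≤ P) (hT : Z ≤ Θ * P) :
    ∑ i ∈ s, Real.sqrt (Zc i * Pc i) ≤ Real.sqrt Θ / L₁ * Real.sqrt (Z * P) := by
  have hZc : ∀ i ∈ s, 0 ≤ Zc i := fun i hi => le_trans (mul_nonneg (sq_nonneg L₁) (hPc i hi)) (hlow i hi)
  -- each term: √(Zc·Pc) ≤ Zc / L₁
  have hterm : ∀ i ∈ s, Real.sqrt (Zc i * Pc i) ≤ Zc i / L₁ := by
    intro i hi
    have h1 : Zc i * Pc i ≤ (Zc i / L₁) ^ 2 := by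
      rw [div_pow]
      rw [le_div_iff₀ (by positivity)]
      have := hlow i hi
      nlinarith [hZc i hi, hPc i hi]
    calc Real.sqrt (Zc i * Pc i) ≤ Real.sqrt ((Zc i / L₁) ^ 2) := Real.sqrt_le_sqrt h1
      _ = Zc i / L₁ := Real.sqrt_sq (div_nonneg (hZc i hi) hL₁.le)
  have hZ0 : 0 ≤ Z := le_trans (Finset.sum_nonneg hZc) hsum
  have hΘP : Z * Z ≤ Θ * (Z * P) := by nlinarith
  calc ∑ i ∈ s, Real.sqrt (Zc i * Pc i) ≤ ∑ i ∈ s, Zc i / L₁ := Finset.sum_le_sum hterm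
    _ = (∑ i ∈ s, Zc i) / L₁ := by rw [Finset.sum_div]
    _ ≤ Z / L₁ := by gcongr
    _ = Real.sqrt (Z * Z) / L₁ := by rw [Real.sqrt_mul_self hZ0]
    _ ≤ Real.sqrt (Θ * (Z * P)) / L₁ := by gcongr
    _ = Real.sqrt Θ / L₁ * Real.sqrt (Z * P) := by
        have hΘ : 0 ≤ Θ ∨ Θ < 0 := le_or_gt 0 Θ
        rcases hΘ with hΘ | hΘ
        · rw [Real.sqrt_mul hΘ]; ring
        · -- Θ < 0 forces Z * P ≤ 0 … handle: Z ≤ Θ P with P ≥ 0, Θ < 0 ⇒ Z ≤ 0 ⇒ Z = 0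
          have hZle : Z ≤ 0 := le_trans hT (mul_nonpos_of_nonpos_of_nonneg hΘ.le hP) |>.trans (le_refl 0)
          have hZ : Z = 0 := le_antisymm hZle hZ0
          simp [hZ]

/-! ## §1c T0 is a THEOREM: efficient late times WITH the Taylor bound (landed `PerFlow.upperLock_at_nearEfficient_times`) -/

/-- **T0 PROVED.**  A violator flow has efficient-times data with a Taylor bound: for every `n`, the landed
`DepletionLadder.PerFlow.upperLock_at_nearEfficient_times` (g4-α: locked times have positive lower log-density, efficient times have
full upper log-density) gives, past the onset `T - T/(n+1)`, a time at which the flow is strictly `κ⋆(1 - 1/(n+2))`-efficient at some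
height bound `M` AND `Z ≤ c₂·ν(T-t)·P`; positivity of `M` and of the budgets follows from the flow-wise sharp inequality
(`flowwise_of_universal sharpDepletion_is_universal`). -/
theorem efficientTimesNoDust_holds : EfficientTimesNoDust := by
  intro C ν T u p hV
  obtain ⟨hC, hν, hT, hsol, hLH, hdec, hrate, hext, hnot⟩ := hV
  obtain ⟨c₂, hc₂⟩ := DepletionLadder.PerFlow.upperLock_at_nearEfficient_times hC hν hT hsol hLH hdec hrate hext hnot
  have hK : 0 < kStar := kStar_pos
  have hfw := DepletionLadder.flowwise_of_universal DepletionLadder.sharpDepletion_is_universal hν hT hsol hLH hdec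
  -- one efficient, Taylor-bounded time past each onset `T - T/(n+1)`
  have key : ∀ n : ℕ, ∃ t : ℝ, t ∈ Set.Ico (T - T / ((n : ℝ) + 1)) T ∧ t ∈ Set.Ico 0 T ∧ ∃ M : ℝ, (∀ x, ‖u t x‖ ≤ M) ∧
      (kStar - kStar / ((n : ℝ) + 2)) * M * Real.sqrt (∫ x, ‖curl (u t) x‖ ^ 2) *
          Real.sqrt (∫ x, frobeniusNormSq (fderiv ℝ (curl (u t)) x)) <
        |∫ x, ⟪curl (u t) x, fderiv ℝ (u t) x (curl (u t) x)⟫_ℝ| ∧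
      (∫ x, ‖curl (u t) x‖ ^ 2) ≤ c₂ * (ν * (T - t)) * ∫ x, frobeniusNormSq (fderiv ℝ (curl (u t)) x) := by
    intro n
    have hn1 : (0 : ℝ) < (n : ℝ) + 1 := by positivity
    have hn2 : (0 : ℝ) < (n : ℝ) + 2 := by positivity
    have hm : 0 < kStar - kStar / ((n : ℝ) + 2) := by
      rw [sub_pos, div_lt_iff₀ hn2]; nlinarith
    have hmlt : kStar - kStar / ((n : ℝ) + 2) < kStar := by
      have : 0 < kStar / ((n : ℝ) + 2) := div_pos hK hn2
      linarith
    have ht₁ : T - T / ((n : ℝ) + 1) ∈ Set.Ico 0 T := by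
      refine ⟨?_, ?_⟩
      · rw [sub_nonneg, div_le_iff₀ hn1]; nlinarith
      · have : 0 < T / ((n : ℝ) + 1) := div_pos hT hn1
        linarith
    have hmlt' := hmlt
    unfold kStar udcSet at hmlt'
    have hne := hc₂ _ hm hmlt' _ ht₁
    obtain ⟨t, ht⟩ := MeasureTheory.nonempty_of_measure_ne_zero hne
    simp only [Set.mem_setOf_eq] at ht
    obtain ⟨htI, ⟨M, hM, hstrict⟩, hZ⟩ := ht
    refine ⟨t, htI, ⟨le_trans ht₁.1 htI.1, htI.2⟩, M, hM, ?_, hZ⟩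
    have := hstrict
    unfold kStar udcSet
    exact this
  choose t htI ht0 M hM hstrict hZ using key
  refine ⟨c₂, t, M, fun n => kStar / ((n : ℝ) + 2), ht0, ?_, ?_, ?_, hM, ?_, ?_, ?_⟩
  · -- `t n → T`: squeezed between `T - T/(n+1)` and `T`
    have hlow : Tendsto (fun n : ℕ => T - T / ((n : ℝ) + 1)) atTop (𝓝 T) := by
      have h1 : Tendsto (fun n : ℕ => T / ((n : ℝ) + 1)) atTop (𝓝 0) :=
        tendsto_const_nhds.div_atTop (tendsto_natCast_atTop_atTop.atTop_add tendsto_const_nhds)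
      simpa using tendsto_const_nhds.sub h1
    exact tendsto_of_tendsto_of_tendsto_of_le_of_le hlow tendsto_const_nhds (fun n => (htI n).1) (fun n => (htI n).2.le)
  · -- `ε n = κ⋆/(n+2) → 0`
    exact tendsto_const_nhds.div_atTop (tendsto_natCast_atTop_atTop.atTop_add tendsto_const_nhds)
  · -- `0 < M n`: else the flow-wise sharp inequality contradicts strict efficiency
    intro n
    have hJle := hfw (t n) (ht0 n) (M n) (hM n)
    have hM0 : 0 ≤ M n := le_trans (norm_nonneg _) (hM n 0)
    by_contra hneg
    have hMz : M n = 0 := le_antisymm (not_lt.1 hneg) hM0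
    have h1 := hstrict n
    rw [hMz] at h1 hJle
    simp only [mul_zero, zero_mul] at h1 hJle
    linarith
  · -- `0 < √Z·√P`: same argument
    intro n
    have hJle := hfw (t n) (ht0 n) (M n) (hM n)
    have h1 := hstrict n
    have hnn : 0 ≤ Real.sqrt (∫ x, ‖curl (u (t n)) x‖ ^ 2) * Real.sqrt (∫ x, frobeniusNormSq (fderiv ℝ (curl (u (t n))) x)) :=
      mul_nonneg (Real.sqrt_nonneg _) (Real.sqrt_nonneg _)
    by_contra hneg
    have hz : Real.sqrt (∫ x, ‖curl (u (t n)) x‖ ^ 2) * Real.sqrt (∫ x, frobeniusNormSq (fderiv ℝ (curl (u (t n))) x)) = 0 :=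
      le_antisymm (not_lt.1 hneg) hnn
    have e1 : (kStar - kStar / ((n : ℝ) + 2)) * M n * Real.sqrt (∫ x, ‖curl (u (t n)) x‖ ^ 2) *
        Real.sqrt (∫ x, frobeniusNormSq (fderiv ℝ (curl (u (t n))) x)) = 0 := by
      rw [mul_assoc, hz, mul_zero]
    have e2 : sInf udcSet * M n * Real.sqrt (∫ x, ‖curl (u (t n)) x‖ ^ 2) *
        Real.sqrt (∫ x, frobeniusNormSq (fderiv ℝ (curl (u (t n))) x)) = 0 := by
      rw [mul_assoc, hz, mul_zero]
    unfold udcSet at e2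
    linarith
  · exact fun n => (hstrict n).le
  · exact hZ

/-! ## §2 The extremal branch is closed UNCONDITIONALLY (landed `extendedSharp` + interior contact + `plateauSliceRigidity`) -/

/-- **No slice of a Type-I ancient mild field is an exactly extremal extended slice.**  Equality in the extended sharp inequality
(`ExtremiserLiouville.extendedSharp`) forces a plateau `{‖W s‖ = M}` with non-empty interior
(`ext_interior_contact_nonempty_of_extremal`), hence of positive volume; the Type-I ancient mild structure (continuity on
`(-∞,0) × ℝ³`, Oseen-mild identity, rate `√(-t)‖W t‖ ≤ K`) then contradicts the landed one-slice plateau rigidity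
`plateauSliceRigidity` (item 27823).  [folklore] -/
theorem not_isExtremalSlice_of_typeIAncientMild {K : ℝ} {W : ℝ → EuclideanSpace ℝ (Fin 3) → EuclideanSpace ℝ (Fin 3)} {s : ℝ}
    (hW : Literature.Analysis.FluidPDE.IsTypeIAncientMild K W) (hs : s < 0) : ¬ IsExtremalSlice (W s) := by
  intro hext
  obtain ⟨hcd, hdiv, ⟨B, hB⟩, h1, h2, M, hM, hpos, hge⟩ := hext
  have hle := extendedSharp (W s) M B hcd hdiv hM hB h1 h2
  have hatt := le_antisymm hle hge
  have hint := ext_interior_contact_nonempty_of_extremal hcd hdiv hM hB h1 h2 hpos hatt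
  have hvol : 0 < volume {x | ‖W s x‖ = M} :=
    lt_of_lt_of_le (isOpen_interior.measure_pos volume hint) (measure_mono interior_subset)
  have hMpos : 0 < M := by
    by_contra hM0
    push Not at hM0
    have hzp : 0 ≤ Real.sqrt (∫ x, ‖curl (W s) x‖ ^ 2) * Real.sqrt (∫ x, frobeniusNormSq (fderiv ℝ (curl (W s)) x)) :=
      mul_nonneg (Real.sqrt_nonneg _) (Real.sqrt_nonneg _)
    have := mul_le_mul_of_nonneg_right hM0 hzp
    rw [mul_assoc] at hpos
    linarith
  have hcont : ContinuousOn (Function.uncurry W) (Set.Iio (0 : ℝ) ×ˢ Set.univ) := hW.continuousOn_uncurry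
  have hmild : ∀ s t : ℝ, s < t → t < 0 → ∀ x, W t x = Literature.Analysis.FluidPDE.heatFlow (W s) (t - s) x -
      Literature.Analysis.FluidPDE.oseenDuhamel 1 s W W t x := hW.2.2.1
  have hdec' : ∀ t : ℝ, t < 0 → ∀ x, Real.sqrt (-t) * ‖W t x‖ ≤ K := by
    intro t ht x
    have hsq : 0 < Real.sqrt (-t) := Real.sqrt_pos.2 (by linarith)
    have h := hW.norm_le ht x
    calc Real.sqrt (-t) * ‖W t x‖ ≤ Real.sqrt (-t) * (K / Real.sqrt (-t)) := by gcongr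
      _ = K := by field_simp
  exact plateauSliceRigidity ⟨W, K, s, M, hcont, hmild, hdec', hs, hMpos, hM, hvol⟩

/-! ## §3 The reduction: T1 → T2 → T3 → the crux BY NAME (T0 is the theorem of §1c, the extremal branch is §2) -/

/-- **The rung `NearExtremalTransiencePerFlow` (26567) from the three open pieces of LINE g7-δ, by name.**  Violator frame by
contradiction → T0 data (theorem) → T2 zoom family + compactness → T1 selection → identification of the limit with a slice `W s` of a
Type-I ancient mild field → extremal branch closed by `not_isExtremalSlice_of_typeIAncientMild`, tube branch = T3. [folklore] -/
theorem nearExtremalTransiencePerFlow_of_selection (hT1 : CoherentSelection) (hT2 : ZoomPackage) (hT3 : NoTubeSlice) :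
    NearExtremalTransiencePerFlow := by
  have hT0 : EfficientTimesNoDust := efficientTimesNoDust_holds
  intro C ν T hC hν hT u p hsol hLH hdec hrate hsing
  by_contra hno
  have hV : IsViolator C ν T u p := ⟨hC, hν, hT, hsol, hLH, hdec, hrate, hsing, hno⟩
  -- T0: near-efficient late times with a Taylor bound
  obtain ⟨Θ, t, Mb, ε, hdata⟩ := hT0 C ν T u p hV
  -- T2: the NS-compatible zoomed slices form a near-extremal family and are zoom-compact
  obtain ⟨σ, Λ, Θ', ε', hσ, hfam, hcomp⟩ := hT2 C ν T u p hV Θ t Mb ε hdata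
  -- T1: coherent selection of a member; its limit is extremal or a tube
  obtain ⟨y, φ, W₀, hφ, hconv, hdich⟩ := hT1 _ Λ Θ' ε' hfam
  -- T2 (compactness at the selected centres): the limit is a slice `W s` of a Type-I ancient mild field
  obtain ⟨ψ, K, s, W, hψ, hW, hs, hconv'⟩ := hcomp y φ hφ
  have hWs : W s = W₀ :=
    funext fun z => tendsto_nhds_unique (hconv' z) ((hconv z).comp hψ.tendsto_atTop)
  subst hWs
  rcases hdich with hext | htube
  · -- extremal branch: equality in the extended sharp inequality ⇒ plateau of positive volume ⇒ `plateauSliceRigidity`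
    exact not_isExtremalSlice_of_typeIAncientMild hW hs hext
  · -- tube branch: the single-slice tube exclusion T3
    exact hT3 K W s hW hs htube

/-! ## §3b Placement of T3 (kernel-checked): the canonical Liouville conjecture (L) implies `NoTubeSlice` -/

/-- `NoTubeSlice` follows from the canonical KNSS Liouville conjecture
`Summit.NavierStokesRegularity.NavierStokesRegularity.LiouvilleConjectureNS` (bounded ancient mild ⇒ slices a.e. constant): shift
time by `δ = -s/2` (`IsTypeIAncientMild.isBoundedAncientMildSolution_sub`), read off that `W s` is a.e. constant, hence constant
(continuity), hence has zero — finite — `Ḣ¹, Ḣ²` budgets, contradicting the infinite-budget clause of `IsTubeSlice`.  So T3 sits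
BELOW (L) and ABOVE item 27695 (single slice instead of a positive-measure set of slices). -/
theorem noTubeSlice_of_liouvilleConjectureNS
    (hL : Summit.NavierStokesRegularity.NavierStokesRegularity.LiouvilleConjectureNS) : NoTubeSlice := by
  intro K W s hW hs htube
  have hδ : 0 < -s / 2 := by linarith
  have hB := hW.isBoundedAncientMildSolution_sub hδ
  have hmeas : ∀ t < 0, AEStronglyMeasurable ((fun t => W (t - -s / 2)) t) volume :=
    fun t ht => hW.aestronglyMeasurable_slice (by linarith)
  obtain ⟨b, hb⟩ := hL _ hB hmeas (s / 2) (by linarith)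
  have e : s / 2 - -s / 2 = s := by ring
  have hb' : W s =ᵐ[volume] fun _ => b := by simpa only [e] using hb
  have hWb : W s = fun _ => b :=
    (Continuous.ae_eq_iff_eq volume (hW.continuous_slice hs) continuous_const).1 hb'
  apply htube.2.2.2.1
  rw [hWb]
  refine ⟨?_, ?_⟩ <;> simp [iteratedFDeriv_const_of_ne]

/-! ## §3c The residual of LINE g7-δ BY NAME: T1 ∧ T3 (T2 is the landed `stub_zoomPackage`) -/

/-- **The rung `NearExtremalTransiencePerFlow` (26567) from the TWO open pieces of LINE g7-δ, by name** — T2 `ZoomPackage` is the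
landed `MemberSelection.stub_zoomPackage` (seat ns-net-p2), so the line's residual is `CoherentSelection` (T1) and `NoTubeSlice` (T3). [folklore] -/
theorem nearExtremalTransiencePerFlow_of_coherentSelection_of_noTubeSlice (hT1 : CoherentSelection) (hT3 : NoTubeSlice) :
    NearExtremalTransiencePerFlow :=
  nearExtremalTransiencePerFlow_of_selection hT1 stub_zoomPackage hT3

/-- The same residual with T3 replaced by the canonical Liouville conjecture (L): `CoherentSelection → LiouvilleConjectureNS → 26567`. [folklore] -/
theorem nearExtremalTransiencePerFlow_of_coherentSelection_of_liouvilleConjectureNS (hT1 : CoherentSelection)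
    (hL : Summit.NavierStokesRegularity.NavierStokesRegularity.LiouvilleConjectureNS) : NearExtremalTransiencePerFlow :=
  nearExtremalTransiencePerFlow_of_coherentSelection_of_noTubeSlice hT1 (noTubeSlice_of_liouvilleConjectureNS hL)

end Summit.NavierStokesRegularity.NavierStokesRegularity.Theorems.NearExtremalTransiencePerFlow.MemberSelection

end
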